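import Summits.CriticalPhenomena.PercolationContinuityZ3.Theorems.Transplant.SkelTubeLevels
import Summits.CriticalPhenomena.PercolationContinuityZ3.Theorems.Transplant.KNCells2ChainSchedCells
import Summits.CriticalPhenomena.PercolationContinuityZ3.Theorems.Transplant.KNLevelsTargetChain
import HarnessLib

/-!
# L6.0a — the corridor chain and the face step over a `PlanarSkeletonConc` as target steps in a WINDOW GRAPH `Skel.winGraph G root Rπ`:
# the packaging records `Skel.WinStepData` / `Skel.WinChainData` (generic twins of p2's `BoxProdZ2.TubeStepData` / `TubeChainData`,
# KNCellsBoxProdZ2ChainT p220599-lineage) — `π ↦ Rπ`, `π ×ˢ Dpl ↦ Φ.Win root Dpl Rπ`, `tubeLData ↦ Skel.winLData` (p1-g7's L5.1)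

builds on p205010 (kernel theorem, internal audit signed; external expert review pending) — nothing in this file uses p205010.
Status sentence (coordinator 2026-08-20T04:30Z): "θ(p_c) = 0 on ℤ^d, all d ≥ 2 — kernel-verified (Lean 4/Mathlib, standard axioms); internal adversarial
audit SIGNED 2026-08-20 04:29Z; external expert review pending."
Lane `prim-bschramm-*`, seat `prim-bschramm-stmt` (gen 7; p2-g3 handed the packaging port to stmt 19:13:45Z); helper file
(`--supports stmt-CriticalPhenomena-4575`).  GENERAL-NODE programme, SHEAR-SCOPE §3.9 Layer 6 ("p2's generic-layer packaging with tube entry points").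
DICTIONARY: the fibre window `π : Finset W` becomes a DEPTH `Rπ` about the root; every product set `π ×ˢ A` becomes the plain window
`Φ.Win root A Rπ` (NOT its vertex span: the pair set `wireSet` of a window and of its span coincide, so `IsSubbox` / `FinSupp` are unaffected,
and the level enclosure `B⟨Rlev+1⟩ ⊆ D` stays `Win_mono`); the window centre IS the source (`root`), as in every use of the product (`π = B(w₀, ·)`,
source `(w₀, 0)`).  Containments INTO scheme regions (vertex spans, `Skel.cellGeomSG`) cost one unit of depth at the consumer (p2-g3's step device).
The planar side (`ChainPlanar.Sched`, `KNCells2ChainSchedCells`: cores / regions / `sBox`) is untouched — the root/corridor chain regions are not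
narrowed (hp-8 g22).
* §1 ONE STEP from planar box data: `WinStepData` (`Rπ`, planar source box `[lo, hi]`, planar region `Dpl`, target `T`, `Rlev N j₀ j₁`, source =
  window centre `root`, support `Sfin`); `Lv = Skel.winLData Φ root Rπ lo hi root Sfin`, `Rg = Φ.Win root Dpl Rπ`, `tstep : TStep (winGraph G root Rπ)`;
  `encl_of_planar`, `Win_subset_X_zero`, **`kitsAt_tstep`** (the packaging of `hface_j` and of the root probe).
* §2 THE CORRIDOR CHAIN over the constant schedule `ChainPlanar.Sched` (87 steps): `WinChainData`; `stepL i`, `stepD i = Win root region_i Rπ`,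
  true target `tgtT i = Win root core_{i+1} Rπ = X^{(i+1)}_0` (linked by construction), `tgtE i = tgtT i ∪ Rim i`, `stepE i`; `stepL_X`, `encl`,
  `tgtT_subset_stepD`, `tgtE_sdiff_subset`, `stepD_subset`, `cube_subset_X_zero`, `tgtT_last_subset`, **`kitsAt_stepE`** (target nonemptiness is a
  hypothesis here: a planar point of the core needs a vertex above it within depth `Rπ`, which the consumer gets from (ι) `step`).
[cite: KozmaNitzan2024, §4 Lemma 10 (p. 17), Lemma 11 (p. 22), Lemma 12 (pp. 23–25), p. 30]
-/

noncomputable section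

open MeasureTheory ProbabilityTheory
open scoped ENNReal

namespace Summit.CriticalPhenomena.PercolationContinuityZ3.Theorems

namespace Transplant

namespace Skel

open Literature.Probability.Percolation Literature.Probability.LatticeModels SimpleGraph
open Literature.Probability.Percolation.KozmaNitzan
open Literature.Probability.Percolation.KozmaNitzan.Cells (sgOf sgOf_sign)
open KNLevels ChainPlanar

variable {V : Type} {G : SimpleGraph V} [G.LocallyFinite] (Φ : PlanarSkeletonConc G)

/-! ## §1 One step from planar box data -/

omit Φ in
/-- **The data of one target step in a window graph** from planar box data (the window centre is the source). [cite: KozmaNitzan2024, §4 Lemma 10 (p. 17)] -/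
structure WinStepData (V : Type) where
  /-- the window depth -/
  Rπ : ℕ
  /-- lower corner of the planar source box -/
  lo : Site 2
  /-- upper corner of the planar source box -/
  hi : Site 2
  /-- the planar region -/
  Dpl : Finset (Site 2)
  /-- the target (enlarged: true target ∪ rim faces) -/
  T : Finset V
  /-- the level depth -/
  Rlev : ℕ
  /-- the number of contacts demanded by Step II -/
  N : ℕ
  /-- the level window -/
  j₀ : ℕ
  /-- the level window -/
  j₁ : ℕ
  /-- the source (= the window centre) -/
  root : V
  /-- the finite support of the weighting -/
  Sfin : Finset V

namespace WinStepData

variable (P : WinStepData V)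

/-- The level data: the window levels of the planar box. [cite: KozmaNitzan2024, §4 Lemma 10 (p. 17)] -/
def Lv : LData (winGraph G P.root P.Rπ) := winLData Φ P.root P.Rπ P.lo P.hi P.root P.Sfin

/-- The region `Win root Dpl Rπ`. [cite: KozmaNitzan2024, §4 Lemma 10 (p. 17: D)] -/
def Rg : Finset V := Φ.Win P.root P.Dpl P.Rπ

/-- **The step.** [cite: KozmaNitzan2024, §4 Lemma 10 (p. 17)] -/
def tstep : TStep (winGraph G P.root P.Rπ) := ⟨P.Lv Φ, P.Rg Φ, P.T, P.Rlev, P.N, P.j₀, P.j₁⟩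

/-- The levels: `X_k = Win root [lo - k, hi + k] Rπ`. [cite: KozmaNitzan2024, §4 p. 15 (B⟨j⟩)] -/
theorem Lv_X (k : ℕ) : (P.Lv Φ).X k = Φ.Win P.root (Finset.Icc (P.lo - (k : Site 2)) (P.hi + (k : Site 2))) P.Rπ := rfl

/-- Membership in the region. [folklore] -/
theorem mem_Rg {v : V} : v ∈ P.Rg Φ ↔ v ∈ Φ.Win P.root P.Dpl P.Rπ := Iff.rfl

/-- The source of the step. [folklore] -/
theorem tstep_o : (P.tstep Φ).L.o = P.root := rfl

/-- The target of the step. [folklore] -/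
theorem tstep_T : (P.tstep Φ).T = P.T := rfl

/-- The region of the step. [folklore] -/
theorem tstep_D : (P.tstep Φ).D = Φ.Win P.root P.Dpl P.Rπ := rfl

variable {P}

/-- **`X_{Rlev+1} ⊆ D`** from the planar containment. [cite: KozmaNitzan2024, §4 Lemma 10 (p. 17: B⟨R+1⟩ ⊆ D)] -/
theorem encl_of_planar (h : Finset.Icc (P.lo - ((P.Rlev + 1 : ℕ) : Site 2)) (P.hi + ((P.Rlev + 1 : ℕ) : Site 2)) ⊆ P.Dpl) :
    (P.Lv Φ).X (P.Rlev + 1) ⊆ P.Rg Φ := by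
  rw [Lv_X]; exact Φ.Win_mono h le_rfl

/-- **A window over a planar subset of the box, of depth at most `Rπ`, lies in `X_0`** (for `hface : Face^{j+1} ⊆ X_0` and for the wired root
seed). [folklore] -/
theorem Win_subset_X_zero {R' : ℕ} {Pl : Finset (Site 2)} (hR : R' ≤ P.Rπ) (hPl : Pl ⊆ Finset.Icc P.lo P.hi) :
    Φ.Win P.root Pl R' ⊆ (P.Lv Φ).X 0 := by
  rw [Lv_X]
  refine Φ.Win_mono ?_ hR
  simpa using hPl

/-- **`KitsAt` of the step** from a subbox region in the window graph, finite support, the source off the region, the planar enclosure, `T ⊆ D`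
nonempty, the count inequality and the per-level kit clause. [cite: KozmaNitzan2024, §4 Lemma 10 (p. 17)] -/
theorem kitsAt_tstep [DecidableEq V] {Wt : Sym2 V → unitInterval} {p : unitInterval} {Δ : ℕ} {δ : ℝ}
    (hsub : KNLevels.IsSubbox (winGraph G P.root P.Rπ) Wt p (P.Rg Φ)) (hfin : FinSupp Wt P.Sfin) (hDS : P.Rg Φ ⊆ P.Sfin)
    (hencl : Finset.Icc (P.lo - ((P.Rlev + 1 : ℕ) : Site 2)) (P.hi + ((P.Rlev + 1 : ℕ) : Site 2)) ⊆ P.Dpl)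
    (ho : P.root ∉ P.Rg Φ) (hoS : P.root ∈ P.Sfin) (hj : P.j₁ ≤ P.Rlev) (hTD : P.T ⊆ P.Rg Φ) (hTne : P.T.Nonempty)
    (hcount : 1 / (1 - (p : ℝ)) ^ (Δ * P.N) ≤ δ * ((Finset.Icc P.j₀ P.j₁).card : ℝ))
    (hkits : ∀ j ∈ Finset.Icc P.j₀ P.j₁, ∃ (σ : SData V) (S : Finset V),
      SHyp (winLData Φ P.root P.Rπ P.lo P.hi P.root P.Sfin) j σ ∧ σ.N ≤ P.N ∧
      (1 - (p : ℝ) ^ σ.sB) ^ σ.k ≤ δ ∧ S ⊆ (winLData Φ P.root P.Rπ P.lo P.hi P.root P.Sfin).X j ∧ S ⊆ P.Rg Φ ∧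
      (∀ x ∈ σ.K, ∀ e ∈ σ.seed x, e ∉ wireSet (↑S : Set V)) ∧ (∀ x ∈ σ.K, σ.face x ⊆ S) ∧
      (∀ x ∈ σ.K, 1 - 3 * δ ≤ (prodBernoulli Wt).real {ω | ∃ u ∈ σ.face x,
        1 - δ < (prodBernoulli (pinW Wt (wireSet (↑S : Set V)) ω)).real (⋃ t ∈ P.T, openConnIn (↑(P.Rg Φ) : Set V) u t)})) :
    (P.tstep Φ).KitsAt Wt p Δ δ := by
  -- `Skel.lhyp_win` is stated with the classical `DecidableEq` instance (L5.1); bridge by subsingleton-ness of instances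
  have hL := lhyp_win Φ P.root P.Rπ P.lo P.hi (Wt := Wt) (p := p) (D := P.Rg Φ) (Rl := P.Rlev) (o := P.root) (Sfin := P.Sfin)
    (by convert hsub) hfin hDS (encl_of_planar Φ hencl) ho hoS
  refine ⟨?_, hj, hTD, hTne, hcount, hkits⟩
  convert hL using 1 <;> rfl

end WinStepData

/-! ## §2 The corridor chain over the constant schedule -/

omit Φ in
/-- **The data of the corridor chain in a window graph.** [cite: KozmaNitzan2024, §4 Lemma 12 (pp. 23–25)] -/
structure WinChainData (V : Type) where
  /-- the window depth -/
  Rπ : ℕ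
  /-- the planar cells -/
  C : PCells
  /-- the examined macro-vertex `x` -/
  x : Site 2
  /-- the onward direction -/
  du : MDir
  /-- the planar unit `t = r / 4` -/
  t : ℕ
  /-- the planar neighbourhood radius `R' ≥ Rlev + 1` -/
  R' : ℕ
  /-- the level depth of every step -/
  Rlev : ℕ
  /-- the number of contacts demanded by Step II -/
  N : ℕ
  /-- the level window -/
  j₀ : ℕ
  /-- the level window -/
  j₁ : ℕ
  /-- the source (= the window centre) -/
  root : V
  /-- the finite support of the weighting -/
  Sfin : Finset V
  /-- the rim part of the enlarged target of step `i` -/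
  Rim : ℕ → Finset V

namespace WinChainData

variable (P : WinChainData V)

/-- Lower corner of core `i`. [folklore] -/
def lo (i : ℕ) : Site 2 :=
  sLo P.du.1 (sgOf P.du) (P.C.cen P.x) (Sched.coreα P.t P.R' i) (Sched.coreβ P.t P.R' i) (Sched.coreW P.t P.R' i)

/-- Upper corner of core `i`. [folklore] -/
def hi (i : ℕ) : Site 2 :=
  sHi P.du.1 (sgOf P.du) (P.C.cen P.x) (Sched.coreα P.t P.R' i) (Sched.coreβ P.t P.R' i) (Sched.coreW P.t P.R' i)

/-- The planar core `i`. [folklore] -/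
def pcore (i : ℕ) : Finset (Site 2) := Sched.core P.t P.R' P.du.1 (sgOf P.du) (P.C.cen P.x) i

/-- The planar region `i`. [folklore] -/
def pregion (i : ℕ) : Finset (Site 2) := Sched.region P.t P.R' P.du.1 (sgOf P.du) (P.C.cen P.x) i

/-- **The level data of step `i`** (window levels). [cite: KozmaNitzan2024, §4 Lemma 10 (p. 17)] -/
def stepL (i : ℕ) : LData (winGraph G P.root P.Rπ) := winLData Φ P.root P.Rπ (P.lo i) (P.hi i) P.root P.Sfin

/-- **The region of step `i`**: `Win root region_i Rπ`. [cite: KozmaNitzan2024, §4 Lemma 10 (p. 17: D)] -/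
def stepD (i : ℕ) : Finset V := Φ.Win P.root (P.pregion i) P.Rπ

/-- **The true target of step `i`**: `Win root core_{i+1} Rπ`. [cite: KozmaNitzan2024, §4 Lemma 10 (p. 17: T)] -/
def tgtT (i : ℕ) : Finset V := Φ.Win P.root (P.pcore (i + 1)) P.Rπ

/-- **The enlarged target of step `i`**: the true target and the rim part. [cite: KozmaNitzan2024, §4 p. 30] -/
def tgtE [DecidableEq V] (i : ℕ) : Finset V := P.tgtT Φ i ∪ P.Rim i

/-- **Step `i` as a target step** (enlarged target). [cite: KozmaNitzan2024, §4 Lemma 12 (pp. 23–25)] -/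
def stepE [DecidableEq V] (i : ℕ) : TStep (winGraph G P.root P.Rπ) := ⟨P.stepL Φ i, P.stepD Φ i, P.tgtE Φ i, P.Rlev, P.N, P.j₀, P.j₁⟩

/-! ### The levels, the link, the containments -/

/-- **The levels of step `i`**: `Win root sBox(coreα i - j, coreβ i + j, coreW i + j) Rπ`. [cite: KozmaNitzan2024, §4 p. 15 (B⟨j⟩)] -/
theorem stepL_X (i j : ℕ) : (P.stepL Φ i).X j =
    Φ.Win P.root (sBox P.du.1 (sgOf P.du) (P.C.cen P.x) (Sched.coreα P.t P.R' i - j) (Sched.coreβ P.t P.R' i + j)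
      (Sched.coreW P.t P.R' i + j)) P.Rπ := by
  show winLevel Φ P.root P.Rπ (P.lo i) (P.hi i) j = _
  rw [winLevel, lo, hi, sBox_enlarge _ _ (sgOf_sign P.du)]

/-- The first level of step `i` is `Win root core_i Rπ`. [folklore] -/
theorem stepL_X_zero (i : ℕ) : (P.stepL Φ i).X 0 = Φ.Win P.root (P.pcore i) P.Rπ := by
  show winLevel Φ P.root P.Rπ (P.lo i) (P.hi i) 0 = _
  rw [winLevel_zero]; rfl

/-- **The true targets link the chain**: `T'_i = X^{(i+1)}_0`. [cite: KozmaNitzan2024, §4 Lemma 12] -/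
theorem tgtT_eq_X_zero (i : ℕ) : P.tgtT Φ i = (P.stepL Φ (i + 1)).X 0 := by
  rw [stepL_X_zero, tgtT]

/-- So the true target of step `i` lies in the first level of step `i + 1`. [folklore] -/
theorem tgtT_subset_X_zero_succ [DecidableEq V] (i : ℕ) : P.tgtT Φ i ⊆ (P.stepE Φ (i + 1)).L.X 0 := by
  rw [P.tgtT_eq_X_zero Φ i]; exact subset_rfl

/-- The true target lies in the enlarged target. [folklore] -/
theorem tgtT_subset_tgtE [DecidableEq V] (i : ℕ) : P.tgtT Φ i ⊆ (P.stepE Φ i).T := Finset.subset_union_left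

/-- The excess part of the enlarged target is inside the rim part. [folklore] -/
theorem tgtE_sdiff_subset [DecidableEq V] (i : ℕ) : (P.stepE Φ i).T \ P.tgtT Φ i ⊆ P.Rim i := by
  intro v hv
  rw [Finset.mem_sdiff] at hv
  rcases Finset.mem_union.1 hv.1 with h | h
  · exact absurd h hv.2
  · exact h

/-- The sources agree. [folklore] -/
theorem stepE_o [DecidableEq V] (i : ℕ) : (P.stepE Φ i).L.o = P.root := rfl

/-- The targets. [folklore] -/
theorem stepE_T [DecidableEq V] (i : ℕ) : (P.stepE Φ i).T = P.tgtE Φ i := rfl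

/-- The regions. [folklore] -/
theorem stepE_D [DecidableEq V] (i : ℕ) : (P.stepE Φ i).D = P.stepD Φ i := rfl

variable {P}

/-- **`X^{(i)}_{Rlev+1} ⊆ D_i`** when `Rlev + 1 ≤ R'`. [cite: KozmaNitzan2024, §4 Lemma 10 (p. 17: B⟨R+1⟩ ⊆ D)] -/
theorem encl (hR : 100 * P.R' ≤ P.t) (hRl : P.Rlev + 1 ≤ P.R') {i : ℕ} (hi : i ≤ Sched.nLast) :
    (P.stepL Φ i).X (P.Rlev + 1) ⊆ P.stepD Φ i := by
  rw [stepL_X, stepD]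
  refine Φ.Win_mono ((sBox_mono (sgOf_sign P.du) _ ?_ ?_ ?_).trans (Sched.enlarge_core_subset_region (sgOf_sign P.du) _ hR hi)) le_rfl <;>
    push_cast <;> omega

/-- **`T'_i ⊆ D_i`.** [folklore] -/
theorem tgtT_subset_stepD (hR : 100 * P.R' ≤ P.t) {i : ℕ} (hi : i ≤ Sched.nLast) : P.tgtT Φ i ⊆ P.stepD Φ i :=
  Φ.Win_mono (Sched.core_succ_subset_region (sgOf_sign P.du) _ hR hi) le_rfl

/-- **`T_i ⊆ D_i`** when the rim part lies in the region. [folklore] -/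
theorem tgtE_subset_stepD [DecidableEq V] (hR : 100 * P.R' ≤ P.t) (hRim : ∀ i, P.Rim i ⊆ P.stepD Φ i) {i : ℕ} (hi : i ≤ Sched.nLast) :
    P.tgtE Φ i ⊆ P.stepD Φ i :=
  Finset.union_subset (tgtT_subset_stepD Φ hR hi) (hRim i)

/-- The planar core of every step is nonempty (so `T'_i` is nonempty as soon as a vertex of depth `≤ Rπ` sits above one of its points).
[folklore] -/
theorem pcore_nonempty (hR : 100 * P.R' ≤ P.t) {i : ℕ} (hi : i ≤ Sched.nLast + 1) : (P.pcore i).Nonempty :=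
  Sched.core_nonempty (sgOf_sign P.du) (P.C.cen P.x) hR hi

/-- **`T'_i` is nonempty** as soon as some vertex of depth `≤ Rπ` has its footprint in the core. [folklore] -/
theorem tgtT_nonempty_of {i : ℕ} {v : V} (hv : v ∈ Literature.Barriers.CriticalPhenomena.graphBall G P.root P.Rπ)
    (hφ : Φ.φ v ∈ P.pcore (i + 1)) : (P.tgtT Φ i).Nonempty :=
  ⟨v, Φ.mem_Win.2 ⟨hv, hφ⟩⟩

/-- **`D_i ⊆ Win root (Q_x ∪ H_{x,y}) Rπ`** (`r = 4t`). [cite: KozmaNitzan2024, §4 p. 30 (E_{v,x} ∪ H_{x,y})] -/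
theorem stepD_subset (hr : P.C.r = 4 * P.t) (hR : 100 * P.R' ≤ P.t) {i : ℕ} (hi : i ≤ Sched.nLast) :
    P.stepD Φ i ⊆ Φ.Win P.root (P.C.Q P.x ∪ P.C.Hfull P.x P.du) P.Rπ :=
  Φ.Win_mono (Sched.region_subset_Q_union_Hfull hr hR hi) le_rfl

/-- **The arrival cube lies in the first core**: `Win root M_x R₀ ⊆ X^{(0)}_0` for `R₀ ≤ Rπ`. [cite: KozmaNitzan2024, §4 p. 28 ((32): M_v)] -/
theorem cube_subset_X_zero (hr : P.C.r = 4 * P.t) (hR : 100 * P.R' ≤ P.t) {R₀ : ℕ} (hR₀ : R₀ ≤ P.Rπ) :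
    Φ.Win P.root (P.C.M P.x) R₀ ⊆ (P.stepL Φ 0).X 0 := by
  rw [stepL_X_zero]
  refine Φ.Win_mono (le_of_eq ?_) hR₀
  rw [pcore, Sched.core_zero_eq_M hr hR]

/-- **The last true target lies in `Win root (M_y ∩ H_{x,y}) Rπ`.** [cite: KozmaNitzan2024, §4 p. 26 (M_x, H_{v,x})] -/
theorem tgtT_last_subset (hr : P.C.r = 4 * P.t) (hR : 100 * P.R' ≤ P.t) :
    P.tgtT Φ Sched.nLast ⊆ Φ.Win P.root (P.C.M (P.x + stepVec P.du) ∩ P.C.Hfull P.x P.du) P.Rπ :=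
  Φ.Win_mono (Finset.subset_inter (Sched.core_last_subset_M hr hR) (Sched.core_last_subset_Hfull hr hR)) le_rfl

/-! ### The kits -/

/-- **`KitsAt` of the enlarged step `i`** from a subbox region in the window graph, finite support, the source off the region, a nonempty true
target, the count inequality and the per-level kit clause towards the ENLARGED target. [cite: KozmaNitzan2024, §4 Lemma 10 (p. 17)] -/
theorem kitsAt_stepE [DecidableEq V] (hR : 100 * P.R' ≤ P.t) (hRl : P.Rlev + 1 ≤ P.R') (hRim : ∀ i, P.Rim i ⊆ P.stepD Φ i)
    {i : ℕ} (hi : i ≤ Sched.nLast) (hTne : (P.tgtT Φ i).Nonempty) {Wt : Sym2 V → unitInterval} {p : unitInterval} {Δ : ℕ} {δ : ℝ}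
    (hsub : KNLevels.IsSubbox (winGraph G P.root P.Rπ) Wt p (P.stepD Φ i)) (hfin : FinSupp Wt P.Sfin) (hDS : P.stepD Φ i ⊆ P.Sfin)
    (ho : P.root ∉ P.stepD Φ i) (hoS : P.root ∈ P.Sfin) (hj : P.j₁ ≤ P.Rlev)
    (hcount : 1 / (1 - (p : ℝ)) ^ (Δ * P.N) ≤ δ * ((Finset.Icc P.j₀ P.j₁).card : ℝ))
    (hkits : ∀ j ∈ Finset.Icc P.j₀ P.j₁, ∃ (σ : SData V) (S : Finset V),
      SHyp (winLData Φ P.root P.Rπ (P.lo i) (P.hi i) P.root P.Sfin) j σ ∧ σ.N ≤ P.N ∧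
      (1 - (p : ℝ) ^ σ.sB) ^ σ.k ≤ δ ∧ S ⊆ (winLData Φ P.root P.Rπ (P.lo i) (P.hi i) P.root P.Sfin).X j ∧ S ⊆ P.stepD Φ i ∧
      (∀ x ∈ σ.K, ∀ e ∈ σ.seed x, e ∉ wireSet (↑S : Set V)) ∧ (∀ x ∈ σ.K, σ.face x ⊆ S) ∧
      (∀ x ∈ σ.K, 1 - 3 * δ ≤ (prodBernoulli Wt).real {ω | ∃ u ∈ σ.face x,
        1 - δ < (prodBernoulli (pinW Wt (wireSet (↑S : Set V)) ω)).real
          (⋃ t ∈ P.tgtE Φ i, openConnIn (↑(P.stepD Φ i) : Set V) u t)})) :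
    (P.stepE Φ i).KitsAt Wt p Δ δ := by
  have hL := lhyp_win Φ P.root P.Rπ (P.lo i) (P.hi i) (Wt := Wt) (p := p) (D := P.stepD Φ i) (Rl := P.Rlev) (o := P.root)
    (Sfin := P.Sfin) (by convert hsub) hfin hDS (encl Φ hR hRl hi) ho hoS
  refine ⟨?_, hj, tgtE_subset_stepD Φ hR hRim hi, hTne.mono (P.tgtT_subset_tgtE Φ i), hcount, hkits⟩
  convert hL using 1 <;> rfl

end WinChainData

end Skel

end Transplant

end Summit.CriticalPhenomena.PercolationContinuityZ3.Theorems

end
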